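import Summits.CriticalPhenomena.Ising3DConformalLimit.Theorems.IsingEuclidUpgradeR4NonGaussianDefs
import HarnessLib

/-!
# Crux `GaussianLimitNotScreened` (stmt-CriticalPhenomena-13886, route PerfectScreening r4): vocabulary of
# the line `karamata-amplitude-blind-merging`

Route-posited objects (D-0016 `<Route>Defs`-type file) shared by the registered stubs of the checked
skeleton `Cruxes/GaussianLimitNotScreened/Lines/karamata_amplitude_blind_merging.lean` (line lead
prover-line-stmt-CriticalPhenomena-13886-0, 2026-08-16) and by the crux file that composes them. Nothing is
asserted here: every declaration is a finite-volume object or a PARAMETRISED predicate over tree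
definitions (`box`, `openConn`, `isingTwoPoint`, `zdGraph`, `criticalBeta`) and over the landed vocabulary
of crux 0636 (`boxG`, `threePointRatio`, `twoStep` of `IsingEuclidUpgradeR4NonGaussianDefs`).

* `traceCluster L ω a` — the cluster `C(a) ∩ Λ_{L+1}` of a site in a bond configuration (for the box law
  `sourcedDoubleCurrentLaw 3 L β ({a}∆{b}) ∅` of the trace: ADC21's sourced double-current cluster
  `C_{n₁+n₂}(a)`);
* `defectG L C c e` — the free box two-point function WITH A FREE DEFECT on `C`, `⟨σ_cσ_e⟩_{Λ_L∖C,β_c}`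
  (the restricted state of ADC21 Lemma A.1);
* `rieszEnergy s C` — the Riesz `s`-energy `∑_{u≠v∈C} ‖u−v‖^{−s}` (sup norm);
* `IsSpreadDefect s K λ ν c e C` — SPREAD `s`-DIMENSIONAL DEFECT relative to the pair `(c,e)`
  (energy form of Frostman/Ahlfors upper `s`-regularity at the scale `R = ‖c − e‖`);
* `oneArmMoment₁/₂`, `energyMoment` — the exact first moment, the Prop. A.3 second-moment bound and the
  energy first-moment bound of the one-arm count `#(C(a) ∩ A)` (ADC21 §4.2, App. A Prop. A.3).
* `stub_vocabulary` — the registered bookkeeping stub through which this file lands `--supports`.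

References: M. Aizenman, H. Duminil-Copin, Ann. of Math. 194 (2021) = arXiv:1912.07973, §3.1–3.2, §4.2
Lemma 4.4, Appendix A (Lemma A.1, Prop. A.3); P. Mattila, *Geometry of Sets and Measures in Euclidean
Spaces* (1995), Chapter 8 (Riesz energies, Frostman's lemma).
-/

noncomputable section

open Filter Topology Set Function MeasureTheory Finset
open Literature.Probability.LatticeModels Literature.Probability.Percolation
open Summit.CriticalPhenomena.Ising3DConformalLimit.Cruxes.IsingEuclidUpgradeR4NonGaussian.FreeCovarianceDeltaDichotomy
  (boxG threePointRatio twoStep)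
open scoped symmDiff

namespace Summit.CriticalPhenomena.Ising3DConformalLimit.Cruxes.GaussianLimitNotScreened.KaramataAmplitudeBlindMerging

/-! ## §A. Finite-volume objects (the free box `Λ_L ⊂ ℤ³` at `β_c(3)`) -/

open Classical in
/-- The cluster `C(a) = {v ∈ Λ_{L+1} | a ↔ v in ω}` of a site in a bond configuration of `ℤ³`, read
inside the vertex set `Λ_{L+1}` of the box graphs — for `ω ∼ P^{ab,∅}_{Λ_L}` (`sourcedDoubleCurrentLaw`)
it is ADC21's sourced double-current cluster `C_{n₁+n₂}(a)`. [cite: AizenmanDuminilCopinAnnals2021, §3.2 and App. A Lemma A.1] -/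
def traceCluster (L : ℕ) (ω : BondConfig (Site 3)) (a : Site 3) : Finset (Site 3) :=
  (box 3 (L + 1)).filter fun v => ω ∈ openConn a v

/-- The two-point function of the free box WITH A FREE DEFECT on `C`:
`⟨σ_cσ_e⟩_{Λ_L∖C,β_c}` (all couplings meeting `C` removed = free Ising model on `Λ_L ∖ C`). [cite: AizenmanDuminilCopinAnnals2021, App. A Lemma A.1 (restricted state)] -/
def defectG (L : ℕ) (C : Finset (Site 3)) (c e : Site 3) : ℝ :=
  isingTwoPoint (zdGraph 3) (box 3 L \ C) (criticalBeta 3) 0 .free c e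

/-- The Riesz `s`-energy `I_s(C) = ∑_{u ≠ v ∈ C} ‖u − v‖^{−s}` of a finite set of sites (sup norm).
[cite: Mattila1995, Chapter 8 (Riesz s-energy)] -/
def rieszEnergy (s : ℝ) (C : Finset (Site 3)) : ℝ :=
  ∑ u ∈ C, ∑ v ∈ C.erase u, (‖u - v‖ : ℝ) ^ (-s)

/-- **SPREAD `s`-DIMENSIONAL DEFECT relative to the pair `(c, e)`** (scale `R = ‖c − e‖`): `C` lies
in the `K R`-ball around `c`, carries at least `ν Rˢ` sites, and its Riesz `s`-energy is at most
`λ R^{−s} (#C)²` (the energy form of Frostman/Ahlfors upper `s`-regularity: no clumping at any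
scale; certifiable by first/second moments of a random cluster). A PARAMETRISED PREDICATE of the line,
not a cited statement. [cite: Mattila1995, Chapter 8 (Riesz energies, Frostman's lemma)] -/
def IsSpreadDefect (s K lam nu : ℝ) (c e : Site 3) (C : Finset (Site 3)) : Prop :=
  (∀ u ∈ C, (‖u - c‖ : ℝ) ≤ K * ‖c - e‖) ∧
    nu * (‖c - e‖ : ℝ) ^ s ≤ (C.card : ℝ) ∧
    rieszEnergy s C ≤ lam * (‖c - e‖ : ℝ) ^ (-s) * (C.card : ℝ) ^ 2

/-! ## §B. Moments of the one-arm count `#(C(a) ∩ A)` under `P^{{a}∆{b},∅}_{Λ_L,β_c}` -/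

/-- FIRST MOMENT of the one-arm count: `M₁ = ∑_{v ∈ A} G_L(a,v)G_L(v,b)/G_L(a,b)` — by the switching
lemma EXACTLY `E^{{a}∆{b},∅}_{Λ_L}[#(C_{n₁+n₂}(a) ∩ A)]`. [cite: AizenmanDuminilCopinAnnals2021, App. A Prop. A.3 (first display)] -/
def oneArmMoment₁ (L : ℕ) (a b : Site 3) (A : Finset (Site 3)) : ℝ :=
  ∑ v ∈ A, threePointRatio L a b v

/-- SECOND-MOMENT BOUND of the one-arm count: `M₂ = ∑_{v,w ∈ A} B_{ab}(v,w)/G_L(a,b) ≥ E[#(C(a) ∩ A)²]`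
(ADC21 Prop. A.3, second display; the diagonal `v = w` is included, where `B_{ab}(v,v) = 2G(a,v)G(v,b)`).
[cite: AizenmanDuminilCopinAnnals2021, App. A Prop. A.3 (second display)] -/
def oneArmMoment₂ (L : ℕ) (a b : Site 3) (A : Finset (Site 3)) : ℝ :=
  ∑ v ∈ A, ∑ w ∈ A, twoStep L a b v w / boxG L a b

/-- FIRST-MOMENT BOUND of the Riesz `s`-energy of `C(a) ∩ A`:
`E_s = ∑_{v ≠ w ∈ A} ‖v − w‖^{−s} B_{ab}(v,w)/G_L(a,b) ≥ E[I_s(C(a) ∩ A)]`.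
[cite: AizenmanDuminilCopinAnnals2021, App. A Prop. A.3 (second display)] -/
def energyMoment (L : ℕ) (a b : Site 3) (s : ℝ) (A : Finset (Site 3)) : ℝ :=
  ∑ v ∈ A, ∑ w ∈ A.erase v, (‖v - w‖ : ℝ) ^ (-s) * (twoStep L a b v w / boxG L a b)

/-! ## §C. Bookkeeping (the registered vocabulary stub through which this file lands `--supports`) -/

/-- **Registered bookkeeping stub `stub_vocabulary`**: a spread defect has at least `ν Rˢ` sites
(the mass clause of `IsSpreadDefect`). [folklore] -/
theorem stub_vocabulary :
    ∀ (s K lam nu : ℝ) (c e : Site 3) (C : Finset (Site 3)), IsSpreadDefect s K lam nu c e C →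
      nu * (‖c - e‖ : ℝ) ^ s ≤ (C.card : ℝ) := by
  intro s K lam nu c e C h
  exact h.2.1

end Summit.CriticalPhenomena.Ising3DConformalLimit.Cruxes.GaussianLimitNotScreened.KaramataAmplitudeBlindMerging

end
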